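/-
Copyright: statement-level skeleton of a published paper (lit-balaban cell, Phase-2 proof seat p13, gen 5). No proof
claims beyond what the kernel checks below.
-/
import Literature.MathematicalPhysics.QuantumFieldTheory.BalabanImbrieJaffe1984to88.BIJ88Ineq246Lattice

/-!
# `BalabanImbrieJaffe1984to88.BIJ88Eq248Lattice` — T. Bałaban, J. Imbrie, A. Jaffe, *Effective action and cluster
properties of the abelian Higgs model*, Commun. Math. Phys. **114** (1988) 257–315 [BalabanImbrieJaffe1988], §2
p. 265 [PDF 9]: **(2.48)**, the `Λ`-INDEPENDENCE OF THE LOCAL PART `C^{(k)}_{Λ,loc}`, PROVED FOR THE `ℤ^d` OPERATORS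
OF [6] = [Balaban1983RegularityDecay] Sect. 5 (the walk terms `BIJ88Eq242Lattice.latticeCw`)

statement-level skeleton of published theorems with citation tags; proofs where landed; nothing here is a claim
about the Yang–Mills mass gap

PDF held: `paper:balaban1988-cmp114-bij-abelian-higgs-effective-action` (journal page = PDF page + 256; p. 265
read with `lit read … --pages 9`).

CITATION HEADER (lean-in-tree rule).  lit-balaban cell (HOME `run/shared/lean/pub/lit-balaban/`), Phase 2, seat p13
gen 5 (unit `lit-balaban-p13-g5`); row **C2.Eq2.48** of `HOME/lit-balaban-r18/ROWS-C2.md` (owner r18, referee ref-5;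
typed by this seat's abstract `BIJ88RandomWalk242.cLoc_congr`, p244240).  Files USED BY NAME, nothing restated:
`…BIJ88RandomWalk242` (`Walk`, `Near`, `cLoc`), `…BIJ88Eq242Lattice` (`flatten`, `latticeCw`), `…BIJ88Ineq246Lattice`
(p251520: `LTup`, `term`, `ldist`, `tsum_indicator_latticeCw_eq`), `…B4Sect5CubeBounds` (the cube system on `ℤ^d`:
`labels`, `cand`, `InBox`, `boxSet`, `hFam`, `pFam`, `cFam`/`cOp`, entry formulas `mulH_apply`, `cOp_apply`,
`rPair_diag_apply`, `rPair_offDiag_apply`), `…B4` (`B4.compress`, `B4.inclIdx`), `…B6GOmega` (`inclIdx_injective`).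

## The print (verbatim, p. 265)

*"If X does not intersect Λ₁ then C^{(k)}_{Λ,X}(u) does not depend on Λ; neither does C^{(k)}_{Λ,loc}(u; x₁, x₂)
depend on Λ if dist({x₁, x₂}, Λ^c) > ½r(e_k). In this case we write it as C^{(k)}_{loc}(u; x₁, x₂) =
C^{(k)}_{Λ,loc}(u; x₁, x₂), Λ large enough. (2.48)"*

## What is proved

For finite `Λ ⊆ Ω ⊂ ℤ^d`, ANY matrix `A` on `L²(Ω; ℝ^N)` and its Dirichlet compression `A_Λ = ΛAΛ`
(`B4.compress`, the `C^{(k)}_Λ = [·|_Λ]^{−1}` of (2.39)/(2.40)), cubes of side `M ≥ 1` and a primed radius `ρ` (label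
units; print `¼r(e_k) = ρM`):
* §1 `Agree`: an operator on `L²(Ω)` and one on `L²(Λ)` AGREE when their entries coincide on `Λ × Λ` and the first
  vanishes on `Λ × (Ω∖Λ)`; agreement is closed under products (`Agree.mul`) — the only algebra needed.
* §2 the factors of the [6] (5.17) walk terms agree: `h_j` and `□_j` for every label (`agree_hFam`, `agree_pFam`),
  `C_j = (A|_{□_j})^{−1}` and `R_{j,j′}` for DEEP labels `j` resp. `j′` — labels whose cube meets `Ω` inside `Λ` only
  (`Deep`; `agree_cFam`, `agree_rPair`), hence `h_jC_jh_j` and `R_{j,j′}C_{j′}h_{j′}` (`agree_aFac`, `agree_bFac`)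
  and the whole walk term of a tuple with deep labels (`agree_term`).
* §3 the primed walks: if `dist(x₁, Ω∖Λ) > (ρ + 2)M` then every label within `ρ` of `x₁` (for `ldist`) is a label
  of `Λ` and deep (`mem_labels_of_near`, `deep_of_near`), so the primed walks of `Ω` for `(x₁, x₂)` are exactly the
  images of the primed walks of `Λ` (`mapTup`, `flatten_mapTup`, `near_map_iff`).
* §4 **(2.48)** `cLoc_eq_of_far`: under `dist(x₁, Ω∖Λ) > (ρ + 2)M`,
  `C_{Ω,loc}(x₁, x₂) = C_{Λ,loc}(x₁, x₂)` — the local part computed in `Ω` (with `A`) and in `Λ` (with `A_Λ`)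
  coincide; in the print's letters `(ρ + 2)M = ¼r(e_k) + 2M ≤ ½r(e_k)` as soon as `r(e_k) ≥ 8M`.  No hypothesis
  (5.6) and no convergence is needed: the identity is termwise (a reindexing of the primed sum); and for two
  volumes `Λ₁, Λ₂ ⊆ Ω` the local parts of `[A|_{Λ₁}]^{−1}`, `[A|_{Λ₂}]^{−1}` coincide (`cLoc_eq_cLoc_of_far`).
* §5 (v1.1, append-only) **(2.48), first clause** *"If X does not intersect Λ₁ then C^{(k)}_{Λ,X}(u) does not depend
  on Λ"*: with the `r(e_k)`-cubes of `BIJ88Ineq246Lattice` (`cubeOf`, `touch`; the cubes of `Λ` are cubes of `Ω`,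
  `eCube`) and the explicit condition `XFar X` (every label of `Ω` whose cube touches a cube of `X` is a deep label
  of `Λ` — the print's «X does not intersect Λ₁» for the cube system), the regions of pushed walks are the pushed
  regions (`region_wmap_eq`), the class-`X` walks of `Ω` are the pushed class-`X` walks of `Λ`
  (`labels_of_region_eq`), and `C_{Ω,X}(ιx₁, ιx₂) = C_{Λ,X}(x₁, x₂)` for all `x₁, x₂ ∈ Λ` (`cX_eq_of_far`; again
  termwise, any `A`, any radius).
HONEST SCOPE.  Operators of [6] Sect. 5 only (as in `BIJ88Eq242Lattice`); the identification with the print's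
`Δ_{k,loc}(u) + aL^{−2}Q(u)*Q(u)` is not made; the first clause of the sentence (about `C^{(k)}_{Λ,X}` and `Λ₁`) is
formalized in §5 (v1.1) with «X does not intersect Λ₁» made the explicit cube-system condition `XFar`.  No `sorry`; no new `Prop` fact.
-/

namespace Literature.MathematicalPhysics.QuantumFieldTheory.BalabanImbrieJaffe1984to88.BIJ88Eq248Lattice

open scoped BigOperators
open Finset
open Literature.MathematicalPhysics.QuantumFieldTheory.Balaban1983to89
open Literature.MathematicalPhysics.QuantumFieldTheory.BalabanImbrieJaffe1984to88
open B4RandomWalk213 B4Sect5RandomWalk B4Sect5CubeBounds B6GOmega BIJ88RandomWalk242 BIJ88Eq242Lattice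
  BIJ88Ineq246Lattice

open scoped Matrix

variable {d N : ℕ} {Ω Λ : Finset (Fin d → ℤ)}

/-! ## §1 Agreement of an operator on `L²(Ω)` with one on `L²(Λ)`, `Λ ⊆ Ω` -/

/-- `X` on `L²(Ω)` AGREES with `Y` on `L²(Λ)`: equal entries on `Λ × Λ`, and `X` vanishes on `Λ × (Ω∖Λ)`.
[cite: BalabanImbrieJaffe1988, (2.48) p.265] -/
def Agree (hΛ : Λ ⊆ Ω) (X : Matrix (B4.Idx Ω N) (B4.Idx Ω N) ℝ) (Y : Matrix (B4.Idx Λ N) (B4.Idx Λ N) ℝ) : Prop :=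
  (∀ p q : B4.Idx Λ N, X (B4.inclIdx hΛ p) (B4.inclIdx hΛ q) = Y p q) ∧
    ∀ (p : B4.Idx Λ N) (s : B4.Idx Ω N), (s.1 : Fin d → ℤ) ∉ Λ → X (B4.inclIdx hΛ p) s = 0

/-- a sum over `L²(Ω)`-indices of a function vanishing off `Λ` is the sum over `L²(Λ)`-indices (bookkeeping for
`A_Λ = ΛAΛ`). [cite: Balaban1983RegularityDecay, Sect. 5 Theorem p.594 (A_Λ = ΛAΛ)] -/
theorem sum_eq_sum_incl (hΛ : Λ ⊆ Ω) (g : B4.Idx Ω N → ℝ) (hg : ∀ s, (s.1 : Fin d → ℤ) ∉ Λ → g s = 0) :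
    ∑ s, g s = ∑ r : B4.Idx Λ N, g (B4.inclIdx hΛ r) := by
  classical
  rw [← Finset.sum_image (f := g) (s := Finset.univ) (g := B4.inclIdx (N := N) hΛ)
    (fun r _ r' _ h => inclIdx_injective hΛ h)]
  refine (Finset.sum_subset (Finset.subset_univ _) fun s _ hs => hg s fun hsΛ => hs ?_).symm
  exact Finset.mem_image.mpr ⟨resIdx s hsΛ, Finset.mem_univ _, inclIdx_resIdx hΛ s hsΛ⟩

namespace Agree

variable {hΛ : Λ ⊆ Ω}

/-- agreement is closed under products. [cite: BalabanImbrieJaffe1988, (2.48) p.265] -/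
theorem mul {X X' : Matrix (B4.Idx Ω N) (B4.Idx Ω N) ℝ} {Y Y' : Matrix (B4.Idx Λ N) (B4.Idx Λ N) ℝ}
    (h : Agree hΛ X Y) (h' : Agree hΛ X' Y') : Agree hΛ (X * X') (Y * Y') := by
  refine ⟨fun p q => ?_, fun p s hs => ?_⟩
  · rw [Matrix.mul_apply, Matrix.mul_apply,
      sum_eq_sum_incl hΛ _ fun s hs => by rw [h.2 p s hs, zero_mul]]
    exact Finset.sum_congr rfl fun r _ => by rw [h.1, h'.1]
  · rw [Matrix.mul_apply, sum_eq_sum_incl hΛ _ fun t ht => by rw [h.2 p t ht, zero_mul]]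
    exact Finset.sum_eq_zero fun r _ => by rw [h'.2 r s hs, mul_zero]

/-- `1` agrees with `1` (bookkeeping for (2.48)). [cite: BalabanImbrieJaffe1988, (2.48) p.265] -/
theorem one (hΛ : Λ ⊆ Ω) : Agree (N := N) hΛ 1 1 := by
  refine ⟨fun p q => ?_, fun p s hs => ?_⟩
  · simp only [Matrix.one_apply, (inclIdx_injective hΛ).eq_iff]
  · rw [Matrix.one_apply, if_neg]
    rintro rfl
    exact hs p.1.2

/-- agreement of finite products `b(q₀)⋯b(q_{n−1})`. [cite: BalabanImbrieJaffe1988, (2.48) p.265] -/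
theorem bprod {ι κ : Type*} (e : κ → ι) {b : ι → Matrix (B4.Idx Ω N) (B4.Idx Ω N) ℝ}
    {b' : κ → Matrix (B4.Idx Λ N) (B4.Idx Λ N) ℝ} :
    ∀ (n : ℕ) (ys : Fin n → κ), (∀ i, Agree hΛ (b (e (ys i))) (b' (ys i))) →
      Agree hΛ (bprod b n (fun i => e (ys i))) (bprod b' n ys) := by
  intro n
  induction n with
  | zero => intro ys _; exact one hΛ
  | succ n ih =>
      intro ys hys
      simp only [B4RandomWalk213.bprod]
      exact (hys 0).mul (ih (Fin.tail ys) fun i => hys i.succ)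

end Agree

/-! ## §2 The factors of [6] (5.17) for `(Ω, A)` and `(Λ, A_Λ)` agree at deep labels -/

/-- labels are monotone in the volume: `labels M Λ ⊆ labels M Ω`. [cite: Balaban1983RegularityDecay, (5.11) p.594] -/
theorem labels_mono (M : ℕ) (hΛ : Λ ⊆ Ω) : labels (d := d) M Λ ⊆ labels M Ω :=
  Finset.biUnion_subset_biUnion_of_subset_left _ hΛ

/-- the inclusion of labels. [cite: Balaban1983RegularityDecay, (5.11) p.594] -/
def eLab (M : ℕ) (hΛ : Λ ⊆ Ω) (l : ↥(labels (d := d) M Λ)) : ↥(labels M Ω) := ⟨l.1, labels_mono M hΛ l.2⟩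

/-- the inclusion of labels is injective (bookkeeping for (2.48)). [cite: BalabanImbrieJaffe1988, (2.48) p.265] -/
theorem eLab_injective (M : ℕ) (hΛ : Λ ⊆ Ω) : Function.Injective (eLab (d := d) M hΛ) := by
  intro l l' h
  have h' := congrArg Subtype.val h
  exact Subtype.ext h'

/-- a DEEP label: its cube meets `Ω` inside `Λ` only (`□_j^Ω = □_j^Λ`). [cite: BalabanImbrieJaffe1988, (2.48) p.265] -/
def Deep (M : ℕ) (Ω Λ : Finset (Fin d → ℤ)) (j : Fin d → ℤ) : Prop := ∀ x ∈ Ω, InBox M j x → x ∈ Λ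

/-- entries of the compression: `A_Λ(p,q) = A(ιp, ιq)`. [cite: Balaban1983RegularityDecay, Sect. 5 Theorem p.594] -/
theorem compress_apply (hΛ : Λ ⊆ Ω) (A : Matrix (B4.Idx Ω N) (B4.Idx Ω N) ℝ) (p q : B4.Idx Λ N) :
    B4.compress hΛ A p q = A (B4.inclIdx hΛ p) (B4.inclIdx hΛ q) := rfl

/-- `h_j` on `L²(Ω)` agrees with `h_j` on `L²(Λ)`. [cite: Balaban1983RegularityDecay, (5.12) p.594] -/
theorem agree_hFam (M : ℕ) (hΛ : Λ ⊆ Ω) (j : ↥(labels (d := d) M Λ)) :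
    Agree (N := N) hΛ (hFam N M Ω (eLab M hΛ j)) (hFam N M Λ j) := by
  refine ⟨fun p q => ?_, fun p s hs => ?_⟩
  · simp only [hFam, mulH_apply, (inclIdx_injective hΛ).eq_iff]
    rfl
  · simp only [hFam, mulH_apply]
    rw [if_neg]
    rintro rfl
    exact hs p.1.2

/-- `□_j` on `L²(Ω)` agrees with `□_j` on `L²(Λ)`. [cite: Balaban1983RegularityDecay, (5.11) p.594] -/
theorem agree_pFam (M : ℕ) (hΛ : Λ ⊆ Ω) (j : ↥(labels (d := d) M Λ)) :
    Agree (N := N) hΛ (pFam N M Ω (eLab M hΛ j)) (pFam N M Λ j) := by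
  refine ⟨fun p q => ?_, fun p s hs => ?_⟩
  · simp only [pFam, mulH_apply, (inclIdx_injective hΛ).eq_iff, boxInd_eq]
    rfl
  · simp only [pFam, mulH_apply]
    rw [if_neg]
    rintro rfl
    exact hs p.1.2

/-- for a deep label the cube of `Ω` is the cube of `Λ`: `□_j^Ω = □_j^Λ` as sets of points.
[cite: BalabanImbrieJaffe1988, (2.48) p.265] -/
theorem boxSet_eq_of_deep {M : ℕ} (hΛ : Λ ⊆ Ω) {j : Fin d → ℤ} (hj : Deep M Ω Λ j) :
    boxSet M Ω j = boxSet M Λ j := by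
  ext x
  simp only [mem_boxSet]
  exact ⟨fun h => ⟨hj x h.1 h.2, h.2⟩, fun h => ⟨hΛ h.1, h.2⟩⟩

/-- the local inverse entries through equal cubes: bookkeeping of `(A|_{□})^{−1}` along `□_j^Ω = □_j^Λ` and
`(A_Λ)|_{□} = A|_{□}`. [cite: Balaban1983RegularityDecay, (5.12) p.594] -/
theorem inv_compress_congr (hΛ : Λ ⊆ Ω) (A : Matrix (B4.Idx Ω N) (B4.Idx Ω N) ℝ) {S T : Finset (Fin d → ℤ)}
    (hST : S = T) (hS : S ⊆ Ω) (hT : T ⊆ Λ) (p q : B4.Idx Λ N)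
    (hp : ((B4.inclIdx hΛ p).1 : Fin d → ℤ) ∈ S) (hq : ((B4.inclIdx hΛ q).1 : Fin d → ℤ) ∈ S)
    (hp' : (p.1 : Fin d → ℤ) ∈ T) (hq' : (q.1 : Fin d → ℤ) ∈ T) :
    (B4.compress hS A)⁻¹ (resIdx (B4.inclIdx hΛ p) hp) (resIdx (B4.inclIdx hΛ q) hq) =
      (B4.compress hT (B4.compress hΛ A))⁻¹ (resIdx p hp') (resIdx q hq') := by
  subst hST
  rfl

/-- `C_j = (A|_{□_j})^{−1}` on `L²(Ω)` agrees with `C_j = (A_Λ|_{□_j})^{−1}` on `L²(Λ)` for deep `j`.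
[cite: Balaban1983RegularityDecay, (5.12) p.594] -/
theorem agree_cFam {M : ℕ} (hΛ : Λ ⊆ Ω) (A : Matrix (B4.Idx Ω N) (B4.Idx Ω N) ℝ) (j : ↥(labels (d := d) M Λ))
    (hj : Deep M Ω Λ j.1) :
    Agree hΛ (cFam M A (eLab M hΛ j)) (cFam M (B4.compress hΛ A) j) := by
  have hbox := boxSet_eq_of_deep (M := M) hΛ hj
  refine ⟨fun p q => ?_, fun p s hs => ?_⟩
  · simp only [cFam, eLab]
    rw [cOp_apply, cOp_apply]
    by_cases hp : (p.1 : Fin d → ℤ) ∈ boxSet M Λ j.1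
    · have hpΩ : ((B4.inclIdx hΛ p).1 : Fin d → ℤ) ∈ boxSet M Ω j.1 := by rw [hbox]; exact hp
      rw [dif_pos hpΩ, dif_pos hp]
      by_cases hq : (q.1 : Fin d → ℤ) ∈ boxSet M Λ j.1
      · have hqΩ : ((B4.inclIdx hΛ q).1 : Fin d → ℤ) ∈ boxSet M Ω j.1 := by rw [hbox]; exact hq
        rw [dif_pos hqΩ, dif_pos hq]
        exact inv_compress_congr hΛ A hbox _ _ p q hpΩ hqΩ hp hq
      · have hqΩ : ((B4.inclIdx hΛ q).1 : Fin d → ℤ) ∉ boxSet M Ω j.1 := by rw [hbox]; exact hq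
        rw [dif_neg hqΩ, dif_neg hq]
    · have hpΩ : ((B4.inclIdx hΛ p).1 : Fin d → ℤ) ∉ boxSet M Ω j.1 := by rw [hbox]; exact hp
      rw [dif_neg hpΩ, dif_neg hp]
  · simp only [cFam, eLab]
    refine cOp_eq_zero_right A _ fun hin => hs ?_
    exact hj _ s.1.2 hin

/-- `R_{j,j′}` on `L²(Ω)` agrees with `R_{j,j′}` on `L²(Λ)` (built from `A_Λ`) when `j′` is deep (for `j = j′`
the two `□_j` cut off `Ω∖Λ`; for `j ≠ j′` the factor `h_{j′}` does). [cite: Balaban1983RegularityDecay, (5.14) p.595] -/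
theorem agree_rPair {M : ℕ} (hM : 0 < M) (hΛ : Λ ⊆ Ω) (A : Matrix (B4.Idx Ω N) (B4.Idx Ω N) ℝ)
    (j j' : ↥(labels (d := d) M Λ)) (hj' : Deep M Ω Λ j'.1) :
    Agree hΛ (rPair A (pFam N M Ω) (hFam N M Ω) (eLab M hΛ j) (eLab M hΛ j'))
      (rPair (B4.compress hΛ A) (pFam N M Λ) (hFam N M Λ) j j') := by
  by_cases hjj : j = j'
  · subst hjj
    refine ⟨fun p q => ?_, fun p s hs => ?_⟩
    · rw [rPair_diag_apply, rPair_diag_apply, compress_apply, boxInd_eq, boxInd_eq, boxInd_eq, boxInd_eq]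
      rfl
    · have hnot : ¬ InBox M ((eLab M hΛ j).1 : Fin d → ℤ) (s.1 : Fin d → ℤ) :=
        fun hin => hs (hj' _ s.1.2 hin)
      rw [rPair_diag_apply, boxInd_eq M (eLab M hΛ j) s.1, if_neg hnot]
      ring
  · have hjj' : eLab M hΛ j ≠ eLab M hΛ j' := fun h => hjj (eLab_injective M hΛ h)
    refine ⟨fun p q => ?_, fun p s hs => ?_⟩
    · rw [rPair_offDiag_apply M A hjj', rPair_offDiag_apply M _ hjj, compress_apply, boxInd_eq, boxInd_eq]
      rfl
    · rw [rPair_offDiag_apply M A hjj']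
      have h0 : hfun M (eLab M hΛ j').1 (s.1 : Fin d → ℤ) = 0 := by
        by_contra hne
        exact hs (hj' _ s.1.2 (inBox_of_hfun_ne_zero hM hne))
      rw [h0]; ring

/-- `h_jC_jh_j` agrees for deep `j`. [cite: Balaban1983RegularityDecay, (5.17) p.595] -/
theorem agree_aFac {M : ℕ} (hΛ : Λ ⊆ Ω) (A : Matrix (B4.Idx Ω N) (B4.Idx Ω N) ℝ) (j : ↥(labels (d := d) M Λ))
    (hj : Deep M Ω Λ j.1) :
    Agree hΛ (aFac (hFam N M Ω) (cFam M A) (eLab M hΛ j))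
      (aFac (hFam N M Λ) (cFam M (B4.compress hΛ A)) j) :=
  ((agree_hFam M hΛ j).mul (agree_cFam hΛ A j hj)).mul (agree_hFam M hΛ j)

/-- `R_{j,j′}C_{j′}h_{j′}` agrees for deep `j′`. [cite: Balaban1983RegularityDecay, (5.17) p.595] -/
theorem agree_bFac {M : ℕ} (hM : 0 < M) (hΛ : Λ ⊆ Ω) (A : Matrix (B4.Idx Ω N) (B4.Idx Ω N) ℝ)
    (q : ↥(labels (d := d) M Λ) × ↥(labels M Λ)) (hq : Deep M Ω Λ q.2.1) :
    Agree hΛ (bFac A (pFam N M Ω) (hFam N M Ω) (cFam M A) (eLab M hΛ q.1, eLab M hΛ q.2))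
      (bFac (B4.compress hΛ A) (pFam N M Λ) (hFam N M Λ) (cFam M (B4.compress hΛ A)) q) :=
  ((agree_rPair hM hΛ A q.1 q.2 hq).mul (agree_cFam hΛ A q.2 hq)).mul (agree_hFam M hΛ q.2)

/-- the tuple with all labels pushed into `labels M Ω`. [cite: BalabanImbrieJaffe1988, (2.48) p.265] -/
def mapTup (M : ℕ) (hΛ : Λ ⊆ Ω) (cc : LTup (d := d) M Λ) : LTup M Ω :=
  ⟨cc.1, eLab M hΛ cc.2.1, fun i => (eLab M hΛ (cc.2.2 i).1, eLab M hΛ (cc.2.2 i).2)⟩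

/-- `mapTup` is injective (the reindexing of the primed sum in (2.48)). [cite: BalabanImbrieJaffe1988, (2.48) p.265] -/
theorem mapTup_injective (M : ℕ) (hΛ : Λ ⊆ Ω) : Function.Injective (mapTup (d := d) M hΛ) := by
  rintro ⟨n, j, ys⟩ ⟨n', j', ys'⟩ h
  simp only [mapTup, Sigma.mk.injEq] at h
  obtain ⟨rfl, h2⟩ := h
  rw [heq_iff_eq, Prod.mk.injEq] at h2
  obtain ⟨hj, hys⟩ := h2
  have hj' : j = j' := eLab_injective M hΛ hj
  subst hj'
  have hys' : ys = ys' := by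
    funext i
    have hi := congrFun hys i
    rw [Prod.mk.injEq] at hi
    exact Prod.ext (eLab_injective M hΛ hi.1) (eLab_injective M hΛ hi.2)
  subst hys'
  rfl

/-- **THE WALK TERMS AGREE**: for a tuple whose start label and second pair labels are deep, the [6] (5.17) walk
term of `(Ω, A)` at `(ιx₁, ιx₂)` equals that of `(Λ, A_Λ)` at `(x₁, x₂)` (and the former vanishes on `Λ × (Ω∖Λ)`).
[cite: BalabanImbrieJaffe1988, (2.48) p.265] -/
theorem agree_term {M : ℕ} (hM : 0 < M) (hΛ : Λ ⊆ Ω) (A : Matrix (B4.Idx Ω N) (B4.Idx Ω N) ℝ) (cc : LTup M Λ)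
    (h0 : Deep M Ω Λ cc.2.1.1) (h2 : ∀ i, Deep M Ω Λ (cc.2.2 i).2.1) :
    Agree hΛ (term M A (mapTup M hΛ cc)) (term M (B4.compress hΛ A) cc) := by
  unfold term walkTerm517
  exact (agree_aFac hΛ A cc.2.1 h0).mul
    (Agree.bprod (fun q : ↥(labels M Λ) × ↥(labels M Λ) => (eLab M hΛ q.1, eLab M hΛ q.2)) cc.1 cc.2.2
      fun i => agree_bFac hM hΛ A (cc.2.2 i) (h2 i))

/-! ## §3 The primed walks of `Ω` near a point deep inside `Λ` are primed walks of `Λ` -/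

/-- the walk with all labels pushed into `labels M Ω`. [cite: BalabanImbrieJaffe1988, (2.48) p.265] -/
def wmap (M : ℕ) (hΛ : Λ ⊆ Ω) (ω : Walk ↥(labels (d := d) M Λ)) : Walk ↥(labels M Ω) :=
  ⟨eLab M hΛ ω.start, ω.len, fun i => eLab M hΛ (ω.steps i)⟩

/-- flattening commutes with the label inclusion. [cite: Balaban1983RegularityDecay, (5.17) p.595] -/
theorem flatten_mapTup (M : ℕ) (hΛ : Λ ⊆ Ω) (cc : LTup (d := d) M Λ) :
    flatten (mapTup M hΛ cc) = wmap M hΛ (flatten cc) := by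
  simp only [flatten, mapTup, wmap]
  congr 1
  funext i
  split_ifs <;> rfl

/-- the labels visited by the pushed walk are the pushed labels. [cite: BalabanImbrieJaffe1988, (2.43) p.264] -/
theorem pts_wmap (M : ℕ) (hΛ : Λ ⊆ Ω) (ω : Walk ↥(labels (d := d) M Λ)) :
    (wmap M hΛ ω).pts = ω.pts.image (eLab M hΛ) := by
  classical
  simp only [Walk.pts, wmap, Finset.image_insert, Finset.image_image]
  rfl

/-- the label-to-site distance is intrinsic: `ldist (ι l) (ι x) = ldist l x`. [cite: BalabanImbrieJaffe1988, (2.43) p.264] -/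
theorem ldist_eLab (M : ℕ) (hΛ : Λ ⊆ Ω) (l : ↥(labels (d := d) M Λ)) (x : B4.Idx Λ N) :
    ldist (N := N) M (eLab M hΛ l) (B4.inclIdx hΛ x) = ldist (N := N) M l x := rfl

/-- primed-ness is intrinsic: the pushed walk is within `ρ` of `(ιx₁, ιx₂)` iff the walk is within `ρ` of
`(x₁, x₂)`. [cite: BalabanImbrieJaffe1988, (2.43) p.264] -/
theorem near_wmap_iff (M : ℕ) (hΛ : Λ ⊆ Ω) (ρ : ℝ) (ω : Walk ↥(labels (d := d) M Λ)) (x₁ x₂ : B4.Idx Λ N) :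
    Near (ldist (N := N) M) ρ (wmap M hΛ ω) (B4.inclIdx hΛ x₁) (B4.inclIdx hΛ x₂) ↔
      Near (ldist (N := N) M) ρ ω x₁ x₂ := by
  classical
  unfold Near
  rw [pts_wmap]
  simp only [Finset.mem_image, forall_exists_index, and_imp, forall_apply_eq_imp_iff₂, ldist_eLab]

/-- *"dist({x₁,x₂},Λ^c) > ½r(e_k)"*, in label units for one point: every point of `Ω∖Λ` is farther than `(ρ + 2)M`
from `x₁`. [cite: BalabanImbrieJaffe1988, (2.48) p.265] -/
def FarFromCompl (M : ℕ) (Ω Λ : Finset (Fin d → ℤ)) (ρ : ℝ) (x : Fin d → ℤ) : Prop :=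
  ∀ y ∈ Ω, y ∉ Λ → (ρ + 2) * M < dist x y

/-- a point of the cube of `l`: `|y − Ml|_∞ ≤ M`. [cite: Balaban1983RegularityDecay, (5.11) p.594] -/
theorem dist_le_of_inBox {M : ℕ} {l y : Fin d → ℤ} (h : InBox M l y) : dist ((M : ℤ) • l) y ≤ M := by
  refine (dist_pi_le_iff (Nat.cast_nonneg M)).mpr fun μ => ?_
  rw [Int.dist_eq]
  obtain ⟨h1, h2⟩ := h μ
  simp only [Pi.smul_apply, smul_eq_mul]
  rw [abs_sub_comm, abs_le]
  constructor
  · exact_mod_cast h1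
  · exact_mod_cast h2.le

/-- a label within `ρ` of a point far from `Ω∖Λ` is deep. [cite: BalabanImbrieJaffe1988, (2.48) p.265] -/
theorem deep_of_near {M : ℕ} (hM : 0 < M) {ρ : ℝ} {x : B4.Idx Λ N} (hx : FarFromCompl M Ω Λ ρ (x.1 : Fin d → ℤ))
    {l : Fin d → ℤ} (hl : dist ((M : ℤ) • l) (x.1 : Fin d → ℤ) / M ≤ ρ) : Deep M Ω Λ l := by
  intro y hy hin
  by_contra hyΛ
  have hfar := hx y hy hyΛ
  have hMr : (0 : ℝ) < M := by exact_mod_cast hM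
  have h1 : dist ((M : ℤ) • l) (x.1 : Fin d → ℤ) ≤ ρ * M := by rwa [div_le_iff₀ hMr] at hl
  have h2 := dist_le_of_inBox hin
  have h3 := dist_triangle (x.1 : Fin d → ℤ) ((M : ℤ) • l) y
  rw [dist_comm (x.1 : Fin d → ℤ) ((M : ℤ) • l)] at h3
  nlinarith

/-- a label of `Ω` within `ρ` of a point far from `Ω∖Λ` is a label of `Λ`. [cite: BalabanImbrieJaffe1988, (2.48) p.265] -/
theorem mem_labels_of_near {M : ℕ} (hM : 0 < M) {hΛ : Λ ⊆ Ω} {ρ : ℝ} {x : B4.Idx Λ N}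
    (hx : FarFromCompl M Ω Λ ρ (x.1 : Fin d → ℤ)) {l : ↥(labels (d := d) M Ω)}
    (hl : ldist (N := N) M l (B4.inclIdx hΛ x) ≤ ρ) : (l.1 : Fin d → ℤ) ∈ labels M Λ := by
  have hdeep : Deep M Ω Λ l.1 := deep_of_near (x := x) hM hx hl
  obtain ⟨y, hy, hly⟩ := Finset.mem_biUnion.mp l.2
  have hin : InBox M l.1 y := (inBox_iff_mem_cand hM l.1 y).mpr hly
  exact Finset.mem_biUnion.mpr ⟨y, hdeep y hy hin, hly⟩

/-- a walk of `Ω` all of whose labels are labels of `Λ` is a pushed walk. [cite: BalabanImbrieJaffe1988, (2.48) p.265] -/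
theorem exists_wmap_eq {M : ℕ} (hΛ : Λ ⊆ Ω) (ω : Walk ↥(labels (d := d) M Ω))
    (h : ∀ l ∈ ω.pts, (l.1 : Fin d → ℤ) ∈ labels M Λ) : ∃ ω₀, wmap M hΛ ω₀ = ω := by
  classical
  refine ⟨⟨⟨ω.start.1, h _ ω.start_mem_pts⟩, ω.len, fun i => ⟨(ω.steps i).1, h _ (ω.steps_mem_pts i)⟩⟩, ?_⟩
  rcases ω with ⟨s, n, ys⟩
  rfl

/-- a tuple of `Ω` all of whose labels are labels of `Λ` is a pushed tuple. [cite: BalabanImbrieJaffe1988, (2.48) p.265] -/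
theorem exists_mapTup_eq {M : ℕ} (hΛ : Λ ⊆ Ω) (cc : LTup (d := d) M Ω)
    (h : ∀ l ∈ (flatten cc).pts, (l.1 : Fin d → ℤ) ∈ labels M Λ) : ∃ cc₀, mapTup M hΛ cc₀ = cc := by
  classical
  obtain ⟨n, j, ys⟩ := cc
  have hj : (j.1 : Fin d → ℤ) ∈ labels M Λ := h _ (flatten ⟨n, j, ys⟩).start_mem_pts
  have h1 : ∀ i : Fin n, ((ys i).1.1 : Fin d → ℤ) ∈ labels M Λ := fun i => by
    have := (flatten ⟨n, j, ys⟩).steps_mem_pts ⟨2 * i.val, by change 2 * i.val < 2 * n; omega⟩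
    simp only [flatten, Nat.mul_mod_right, ↓reduceIte] at this
    have hdiv : 2 * i.val / 2 = i.val := by omega
    simp only [hdiv] at this
    exact h _ this
  have h2 : ∀ i : Fin n, ((ys i).2.1 : Fin d → ℤ) ∈ labels M Λ := fun i => by
    have := (flatten ⟨n, j, ys⟩).steps_mem_pts ⟨2 * i.val + 1, by change 2 * i.val + 1 < 2 * n; omega⟩
    simp only [flatten, Nat.mul_add_mod, Nat.one_mod, one_ne_zero, ↓reduceIte] at this
    have hdiv : (2 * i.val + 1) / 2 = i.val := by omega
    simp only [hdiv] at this
    exact h _ this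
  refine ⟨⟨n, ⟨j.1, hj⟩, fun i => (⟨(ys i).1.1, h1 i⟩, ⟨(ys i).2.1, h2 i⟩)⟩, ?_⟩
  rfl

/-! ## §4 (2.48): the local part does not depend on the volume -/

/-- **(2.48) FOR THE `ℤ^d` OPERATORS OF [6]** — *"neither does C^{(k)}_{Λ,loc}(u; x₁, x₂) depend on Λ if
dist({x₁, x₂}, Λ^c) > ½r(e_k). In this case we write it as C^{(k)}_{loc}(u; x₁, x₂) = C^{(k)}_{Λ,loc}(u; x₁, x₂), Λ
large enough. (2.48)"*: for finite `Λ ⊆ Ω ⊂ ℤ^d`, ANY `A` on `L²(Ω; ℝ^N)` with Dirichlet compression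
`A_Λ = B4.compress hΛ A`, cubes `M ≥ 1`, radius `ρ`, and `x₁, x₂ ∈ Λ` with `dist(x₁, Ω∖Λ) > (ρ + 2)M`:
`C_{Ω,loc}(ιx₁, ιx₂) = C_{Λ,loc}(x₁, x₂)` — the primed sums over the walks of `Ω` (terms of `A`) and of `Λ` (terms of
`A_Λ`) coincide term by term. [cite: BalabanImbrieJaffe1988, (2.48) p.265] -/
theorem cLoc_eq_of_far {M : ℕ} (hM : 0 < M) (hΛ : Λ ⊆ Ω) (A : Matrix (B4.Idx Ω N) (B4.Idx Ω N) ℝ) (ρ : ℝ)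
    (x₁ x₂ : B4.Idx Λ N) (hfar : FarFromCompl M Ω Λ ρ (x₁.1 : Fin d → ℤ)) :
    cLoc (ldist (N := N) M) ρ (fun ω y₁ y₂ => latticeCw M Ω N A ω y₁ y₂) (B4.inclIdx hΛ x₁) (B4.inclIdx hΛ x₂)
      = cLoc (ldist (N := N) M) ρ (fun ω y₁ y₂ => latticeCw M Λ N (B4.compress hΛ A) ω y₁ y₂) x₁ x₂ := by
  classical
  unfold cLoc
  rw [tsum_indicator_latticeCw_eq A _ (B4.inclIdx hΛ x₁) (B4.inclIdx hΛ x₂),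
    tsum_indicator_latticeCw_eq (B4.compress hΛ A) _ x₁ x₂]
  set TΩ : Set (Walk ↥(labels M Ω)) :=
    {ω | Near (ldist (N := N) M) ρ ω (B4.inclIdx hΛ x₁) (B4.inclIdx hΛ x₂)} with hTΩ
  set TΛ : Set (Walk ↥(labels M Λ)) := {ω | Near (ldist (N := N) M) ρ ω x₁ x₂} with hTΛ
  -- the Ω-summand is supported on pushed tuples
  have hsupp : Function.support (fun cc : LTup M Ω =>
      (flatten ⁻¹' TΩ).indicator (fun cc => term M A cc (B4.inclIdx hΛ x₁) (B4.inclIdx hΛ x₂)) cc)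
        ⊆ Set.range (mapTup M hΛ) := by
    intro cc hcc
    rw [Function.mem_support] at hcc
    have hmem : cc ∈ flatten ⁻¹' TΩ := by
      by_contra hn; exact hcc (Set.indicator_of_notMem hn _)
    have hnear : Near (ldist (N := N) M) ρ (flatten cc) (B4.inclIdx hΛ x₁) (B4.inclIdx hΛ x₂) := hmem
    obtain ⟨cc₀, hcc₀⟩ := exists_mapTup_eq hΛ cc fun l hl => mem_labels_of_near hM hfar (hnear l hl).1
    exact ⟨cc₀, hcc₀⟩
  rw [← (mapTup_injective M hΛ).tsum_eq hsupp]
  refine tsum_congr fun cc => ?_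
  -- primed-ness transfers, and on primed tuples the terms agree
  have hiff : mapTup M hΛ cc ∈ flatten ⁻¹' TΩ ↔ cc ∈ flatten ⁻¹' TΛ := by
    simp only [Set.mem_preimage, hTΩ, hTΛ, Set.mem_setOf_eq, flatten_mapTup, near_wmap_iff]
  by_cases hmem : cc ∈ flatten ⁻¹' TΛ
  · rw [Set.indicator_of_mem (hiff.mpr hmem), Set.indicator_of_mem hmem]
    have hnear : Near (ldist (N := N) M) ρ (flatten cc) x₁ x₂ := hmem
    have hdeep : ∀ l ∈ (flatten cc).pts, Deep M Ω Λ l.1 := fun l hl =>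
      deep_of_near (x := x₁) hM hfar (hnear l hl).1
    refine (agree_term hM hΛ A cc (hdeep _ (flatten cc).start_mem_pts) fun i => hdeep _ ?_).1 x₁ x₂
    have := (flatten cc).steps_mem_pts ⟨2 * i.val + 1, by change 2 * i.val + 1 < 2 * cc.1; omega⟩
    simp only [flatten, Nat.mul_add_mod, Nat.one_mod, one_ne_zero, ↓reduceIte] at this
    have hdiv : (2 * i.val + 1) / 2 = i.val := by omega
    simp only [hdiv] at this
    exact this
  · rw [Set.indicator_of_notMem (fun h => hmem (hiff.mp h)), Set.indicator_of_notMem hmem]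

/-- **(2.48), TWO VOLUMES**: for `Λ₁, Λ₂ ⊆ Ω` both containing `x₁, x₂`, with `dist(x₁, Ω∖Λ_i) > (ρ + 2)M`
(`i = 1, 2`), the local parts of the Dirichlet operators `[A|_{Λ₁}]^{−1}` and `[A|_{Λ₂}]^{−1}` coincide at
`(x₁, x₂)`: *"C^{(k)}_{loc}(u; x₁, x₂) = C^{(k)}_{Λ,loc}(u; x₁, x₂), Λ large enough"*. [cite: BalabanImbrieJaffe1988, (2.48) p.265] -/
theorem cLoc_eq_cLoc_of_far {M : ℕ} (hM : 0 < M) {Λ₁ Λ₂ : Finset (Fin d → ℤ)} (h₁ : Λ₁ ⊆ Ω) (h₂ : Λ₂ ⊆ Ω)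
    (A : Matrix (B4.Idx Ω N) (B4.Idx Ω N) ℝ) (ρ : ℝ) (x₁ x₂ : B4.Idx Ω N)
    (hx₁ : (x₁.1 : Fin d → ℤ) ∈ Λ₁) (hx₂ : (x₂.1 : Fin d → ℤ) ∈ Λ₁) (hx₁' : (x₁.1 : Fin d → ℤ) ∈ Λ₂)
    (hx₂' : (x₂.1 : Fin d → ℤ) ∈ Λ₂) (hfar₁ : FarFromCompl M Ω Λ₁ ρ (x₁.1 : Fin d → ℤ))
    (hfar₂ : FarFromCompl M Ω Λ₂ ρ (x₁.1 : Fin d → ℤ)) :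
    cLoc (ldist (N := N) M) ρ (fun ω y₁ y₂ => latticeCw M Λ₁ N (B4.compress h₁ A) ω y₁ y₂)
        (resIdx x₁ hx₁) (resIdx x₂ hx₂)
      = cLoc (ldist (N := N) M) ρ (fun ω y₁ y₂ => latticeCw M Λ₂ N (B4.compress h₂ A) ω y₁ y₂)
        (resIdx x₁ hx₁') (resIdx x₂ hx₂') := by
  rw [← cLoc_eq_of_far hM h₁ A ρ (resIdx x₁ hx₁) (resIdx x₂ hx₂) hfar₁,
    ← cLoc_eq_of_far hM h₂ A ρ (resIdx x₁ hx₁') (resIdx x₂ hx₂') hfar₂]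
  rfl

/-! ## §5 (2.48), first clause: the `X`-parts `C^{(k)}_{Λ,X}` do not depend on the volume (v1.1) -/

/-- the `r(e_k)`-cubes of `Λ` are `r(e_k)`-cubes of `Ω`. [cite: BalabanImbrieJaffe1988, (2.44) p.264] -/
theorem cubes_mono (M s : ℕ) (hΛ : Λ ⊆ Ω) :
    (labels (d := d) M Λ).image (cubeLab s) ⊆ (labels M Ω).image (cubeLab s) :=
  Finset.image_subset_image (labels_mono M hΛ)

/-- the inclusion of cubes. [cite: BalabanImbrieJaffe1988, (2.44) p.264] -/
def eCube (M s : ℕ) (hΛ : Λ ⊆ Ω) (c : Cubes (d := d) M s Λ) : Cubes M s Ω := ⟨c.1, cubes_mono M s hΛ c.2⟩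

/-- the inclusion of cubes is injective (bookkeeping for (2.48)). [cite: BalabanImbrieJaffe1988, (2.48) p.265] -/
theorem eCube_injective (M s : ℕ) (hΛ : Λ ⊆ Ω) : Function.Injective (eCube (d := d) M s hΛ) := by
  intro c c' h
  have h' := congrArg Subtype.val h
  exact Subtype.ext h'

/-- the cube of a pushed label is the pushed cube. [cite: BalabanImbrieJaffe1988, (2.44) p.264] -/
theorem cubeOf_eLab (M s : ℕ) (hΛ : Λ ⊆ Ω) (l : ↥(labels (d := d) M Λ)) :
    cubeOf M s (eLab M hΛ l) = eCube M s hΛ (cubeOf M s l) := rfl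

/-- touching is intrinsic. [cite: BalabanImbrieJaffe1988, (2.44) p.264] -/
theorem touch_eCube_iff (M s : ℕ) (hΛ : Λ ⊆ Ω) (c c' : Cubes (d := d) M s Λ) :
    touch (eCube M s hΛ c) (eCube M s hΛ c') ↔ touch c c' := Iff.rfl

/-- the cubes met by the pushed walk are the pushed cubes met. [cite: BalabanImbrieJaffe1988, (2.44) p.264] -/
theorem cubesMet_wmap (M s : ℕ) (hΛ : Λ ⊆ Ω) (ω : Walk ↥(labels (d := d) M Λ)) :
    cubesMet (cubeOf M s) (wmap M hΛ ω) = (cubesMet (cubeOf M s) ω).image (eCube M s hΛ) := by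
  classical
  unfold cubesMet
  rw [pts_wmap, Finset.image_image, Finset.image_image]
  rfl

/-- *"If X does not intersect Λ₁"* made explicit for the cube system: every label of `Ω` whose cube touches a cube of
`X` is a label of `Λ` and deep. [cite: BalabanImbrieJaffe1988, (2.48) p.265] -/
def XFar (M s : ℕ) (Ω Λ : Finset (Fin d → ℤ)) (X : Finset (Cubes (d := d) M s Λ)) : Prop :=
  ∀ l ∈ labels M Ω, (∃ c ∈ X, Adj (cubeLab s l) c.1) → l ∈ labels M Λ ∧ Deep M Ω Λ l

/-- under `XFar X`, the region of a pushed walk with region `X` is the pushed `X`. [cite: BalabanImbrieJaffe1988, (2.48) p.265] -/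
theorem region_wmap_eq {M s : ℕ} (hΛ : Λ ⊆ Ω) {X : Finset (Cubes (d := d) M s Λ)} (hX : XFar M s Ω Λ X)
    (ω : Walk ↥(labels M Λ)) (hω : region (cubeOf M s) touch ω = X) :
    region (cubeOf M s) touch (wmap M hΛ ω) = X.image (eCube M s hΛ) := by
  classical
  have hsub : cubesMet (cubeOf M s) ω ⊆ X := by rw [← hω]; exact subset_closure _ _
  apply Finset.Subset.antisymm
  · intro c' hc'
    unfold region at hc'
    rw [cubesMet_wmap] at hc'
    rcases mem_closure.mp hc' with h1 | ⟨c, hc, hcc⟩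
    · obtain ⟨c, hc, rfl⟩ := Finset.mem_image.mp h1
      exact Finset.mem_image_of_mem _ (hsub hc)
    · obtain ⟨c₀, hc₀, rfl⟩ := Finset.mem_image.mp hc
      -- `c'` is the cube of some label of `Ω`; that label touches `c₀ ∈ X`, hence is a label of `Λ`
      obtain ⟨l', hl', hc'l⟩ := Finset.mem_image.mp c'.2
      have hadj : Adj (cubeLab s l') c₀.1 := fun μ => by rw [abs_sub_comm, hc'l]; exact hcc μ
      obtain ⟨hl'Λ, -⟩ := hX l' hl' ⟨c₀, hsub hc₀, hadj⟩
      have hc'eq : eCube M s hΛ ⟨cubeLab s l', Finset.mem_image_of_mem _ hl'Λ⟩ = c' := Subtype.ext hc'l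
      rw [← hc'eq]
      refine Finset.mem_image_of_mem _ ?_
      rw [← hω]
      exact mem_closure.mpr (Or.inr ⟨c₀, hc₀, fun μ => by rw [abs_sub_comm]; exact hadj μ⟩)
  · intro c' hc'
    obtain ⟨c, hc, rfl⟩ := Finset.mem_image.mp hc'
    rw [← hω] at hc
    unfold region at hc ⊢
    rw [cubesMet_wmap]
    rcases mem_closure.mp hc with hc | ⟨c₀, hc₀, hcc⟩
    · exact mem_closure.mpr (Or.inl (Finset.mem_image_of_mem _ hc))
    · exact mem_closure.mpr (Or.inr ⟨eCube M s hΛ c₀, Finset.mem_image_of_mem _ hc₀, hcc⟩)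

/-- under `XFar X`, a walk of `Ω` whose region is the pushed `X` has all its labels in `Λ`, deep.
[cite: BalabanImbrieJaffe1988, (2.48) p.265] -/
theorem labels_of_region_eq {M s : ℕ} (hΛ : Λ ⊆ Ω) {X : Finset (Cubes (d := d) M s Λ)} (hX : XFar M s Ω Λ X)
    (ω : Walk ↥(labels M Ω)) (hω : region (cubeOf M s) touch ω = X.image (eCube M s hΛ)) :
    ∀ l ∈ ω.pts, (l.1 : Fin d → ℤ) ∈ labels M Λ ∧ Deep M Ω Λ l.1 := by
  classical
  intro l hl
  have hc : cubeOf M s l ∈ X.image (eCube M s hΛ) := by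
    rw [← hω]; exact subset_closure _ _ (Finset.mem_image_of_mem _ hl)
  obtain ⟨c, hcX, hc⟩ := Finset.mem_image.mp hc
  refine hX l.1 l.2 ⟨c, hcX, fun μ => ?_⟩
  have : (cubeOf M s l).1 = c.1 := by rw [← hc]; rfl
  have hμ : cubeLab s l.1 μ = c.1 μ := congrFun this μ
  rw [hμ, sub_self, abs_zero]; exact zero_le_one

/-- **(2.48), FIRST CLAUSE, FOR THE `ℤ^d` OPERATORS OF [6]** — *"If X does not intersect Λ₁ then C^{(k)}_{Λ,X}(u)
does not depend on Λ"*: for finite `Λ ⊆ Ω ⊂ ℤ^d`, ANY `A` on `L²(Ω; ℝ^N)`, `A_Λ = B4.compress hΛ A`, cubes `M ≥ 1`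
grouped in `r(e_k)`-cubes of `s` labels, radius `ρ`, and a cube set `X` of `Λ` with `XFar X` (every label of `Ω`
whose cube touches `X` is a deep label of `Λ`): `C_{Ω,X}(ιx₁, ιx₂) = C_{Λ,X}(x₁, x₂)` for all `x₁, x₂ ∈ Λ` (the
`X` of `Ω` being the pushed `X`). [cite: BalabanImbrieJaffe1988, (2.48) p.265] -/
theorem cX_eq_of_far {M s : ℕ} (hM : 0 < M) (hΛ : Λ ⊆ Ω) (A : Matrix (B4.Idx Ω N) (B4.Idx Ω N) ℝ) (ρ : ℝ)
    {X : Finset (Cubes (d := d) M s Λ)} (hX : XFar M s Ω Λ X) (x₁ x₂ : B4.Idx Λ N) :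
    cX (ldist (N := N) M) ρ (cubeOf M s) touch (fun ω y₁ y₂ => latticeCw M Ω N A ω y₁ y₂)
        (X.image (eCube M s hΛ)) (B4.inclIdx hΛ x₁) (B4.inclIdx hΛ x₂)
      = cX (ldist (N := N) M) ρ (cubeOf M s) touch (fun ω y₁ y₂ => latticeCw M Λ N (B4.compress hΛ A) ω y₁ y₂)
        X x₁ x₂ := by
  classical
  unfold cX
  rw [tsum_indicator_latticeCw_eq A _ (B4.inclIdx hΛ x₁) (B4.inclIdx hΛ x₂),
    tsum_indicator_latticeCw_eq (B4.compress hΛ A) _ x₁ x₂]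
  set TΩ : Set (Walk ↥(labels M Ω)) :=
    {ω | ¬ Near (ldist (N := N) M) ρ ω (B4.inclIdx hΛ x₁) (B4.inclIdx hΛ x₂) ∧
      region (cubeOf M s) touch ω = X.image (eCube M s hΛ)} with hTΩ
  set TΛ : Set (Walk ↥(labels M Λ)) :=
    {ω | ¬ Near (ldist (N := N) M) ρ ω x₁ x₂ ∧ region (cubeOf M s) touch ω = X} with hTΛ
  have hsupp : Function.support (fun cc : LTup M Ω =>
      (flatten ⁻¹' TΩ).indicator (fun cc => term M A cc (B4.inclIdx hΛ x₁) (B4.inclIdx hΛ x₂)) cc)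
        ⊆ Set.range (mapTup M hΛ) := by
    intro cc hcc
    rw [Function.mem_support] at hcc
    have hmem : cc ∈ flatten ⁻¹' TΩ := by
      by_contra hn; exact hcc (Set.indicator_of_notMem hn _)
    have hreg : region (cubeOf M s) touch (flatten cc) = X.image (eCube M s hΛ) := hmem.2
    obtain ⟨cc₀, hcc₀⟩ := exists_mapTup_eq hΛ cc fun l hl => (labels_of_region_eq hΛ hX _ hreg l hl).1
    exact ⟨cc₀, hcc₀⟩
  rw [← (mapTup_injective M hΛ).tsum_eq hsupp]
  refine tsum_congr fun cc => ?_
  by_cases hmem : cc ∈ flatten ⁻¹' TΛ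
  · have hreg : region (cubeOf M s) touch (flatten cc) = X := hmem.2
    have hmem' : mapTup M hΛ cc ∈ flatten ⁻¹' TΩ := by
      refine ⟨?_, ?_⟩
      · rw [flatten_mapTup, near_wmap_iff]; exact hmem.1
      · rw [flatten_mapTup]; exact region_wmap_eq hΛ hX _ hreg
    rw [Set.indicator_of_mem hmem', Set.indicator_of_mem hmem]
    have hdeep : ∀ l ∈ (flatten cc).pts, Deep M Ω Λ l.1 := fun l hl => by
      have h := labels_of_region_eq hΛ hX (wmap M hΛ (flatten cc))
        (region_wmap_eq hΛ hX _ hreg) (eLab M hΛ l)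
        (by rw [pts_wmap]; exact Finset.mem_image_of_mem _ hl)
      exact h.2
    refine (agree_term hM hΛ A cc (hdeep _ (flatten cc).start_mem_pts) fun i => hdeep _ ?_).1 x₁ x₂
    have := (flatten cc).steps_mem_pts ⟨2 * i.val + 1, by change 2 * i.val + 1 < 2 * cc.1; omega⟩
    simp only [flatten, Nat.mul_add_mod, Nat.one_mod, one_ne_zero, ↓reduceIte] at this
    have hdiv : (2 * i.val + 1) / 2 = i.val := by omega
    simp only [hdiv] at this
    exact this
  · have hmem' : mapTup M hΛ cc ∉ flatten ⁻¹' TΩ := by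
      rintro ⟨hfar', hreg'⟩
      rw [flatten_mapTup] at hreg' hfar'
      apply hmem
      refine ⟨fun h => hfar' ((near_wmap_iff M hΛ ρ _ x₁ x₂).mpr h), ?_⟩
      -- pull the region back along the injective cube inclusion
      -- region of the Λ-walk: its push-forward is the region of the pushed walk
      have key : (region (cubeOf M s) touch (flatten cc)).image (eCube M s hΛ) = X.image (eCube M s hΛ) := by
        rw [← hreg']
        unfold region
        rw [cubesMet_wmap]
        apply Finset.Subset.antisymm
        · intro c' hc'
          obtain ⟨c, hc, rfl⟩ := Finset.mem_image.mp hc'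
          rcases mem_closure.mp hc with hc | ⟨c₀, hc₀, hcc⟩
          · exact mem_closure.mpr (Or.inl (Finset.mem_image_of_mem _ hc))
          · exact mem_closure.mpr (Or.inr ⟨eCube M s hΛ c₀, Finset.mem_image_of_mem _ hc₀, hcc⟩)
        · intro c' hc'
          rcases mem_closure.mp hc' with h1 | ⟨c, hc, hcc⟩
          · obtain ⟨c, hc, rfl⟩ := Finset.mem_image.mp h1
            exact Finset.mem_image_of_mem _ (subset_closure _ _ hc)
          · obtain ⟨c₀, hc₀, rfl⟩ := Finset.mem_image.mp hc
            -- `c'` lies in the region of the pushed walk `= X.image`, so it is a pushed cube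
            have hc'reg : c' ∈ region (cubeOf M s) touch (wmap M hΛ (flatten cc)) := by
              unfold region; rw [cubesMet_wmap]
              exact mem_closure.mpr (Or.inr ⟨eCube M s hΛ c₀, Finset.mem_image_of_mem _ hc₀, hcc⟩)
            rw [hreg'] at hc'reg
            obtain ⟨c₁, -, rfl⟩ := Finset.mem_image.mp hc'reg
            exact Finset.mem_image_of_mem _ (mem_closure.mpr (Or.inr ⟨c₀, hc₀, hcc⟩))
      exact Finset.image_injective (eCube_injective M s hΛ) key
    rw [Set.indicator_of_notMem hmem', Set.indicator_of_notMem hmem]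

end Literature.MathematicalPhysics.QuantumFieldTheory.BalabanImbrieJaffe1984to88.BIJ88Eq248Lattice
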